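import Mathlib
import Literature.AlgebraicGeometry.Resolution.AffineBlowupUniversal
import Literature.AlgebraicGeometry.Resolution.BlowupsFlatBaseChange
import Literature.AlgebraicGeometry.Resolution.IdealSheafLemmas
import Literature.AlgebraicGeometry.Resolution.ResolutionGlue
import Summits.ResolutionOfSingularities.ResolutionOfSingularities.Theorems.WildQuotientsWildQuotientResolutionHalf111Blowup
import Summits.ResolutionOfSingularities.ResolutionOfSingularities.Theorems.WildQuotientsWildQuotientResolutionJordanFourConeVertexIdeals

/-!
# V4U cone bricks, cone side (2): the `μ₂` exit blow-up stays regular after localising the cone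

(crux stmt-ResolutionOfSingularities-15640 `WildQuotients.WildQuotientResolution`, line `Sketch`,
sector `|G| = p`; programme V4U of `L/w45c/CHAIN.md` v7.1 §4, RULING v7.1 — ingredient «blow-up
under the flat base change `Γ ↦ Γ[1/Q]`» of the `μ₂` CONE BRICK `HP₁` of
`JordanFour.jordanFour_hasResolution_of_bricks` (lead-1 p501160): the `μ₂` piece downstairs is the
`½(1,1,1) × 𝔸` cone LOCALISED at the invariant `Q` (`V4U-DESIGN.md` §3), so the consumer
(`BlowupExit.exists_isBlowup_regular_of_iso_spec_of_ringEquiv`, p489276) needs the regularity of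
`Bl_{𝔪₂·A[1/q]}(Spec A[1/q])`, not only of `Bl_{𝔪₂}(Spec A)` (`Half111.blowup_regular`, p500272).
[OURS · L1 W4.5c] — NOT a statement of any manuscript; replaces the role of no printed item.
Prover res-L1-w45c-stub-4.)

* `ConeVertex.isRegular_affineBlowup_map_of_isLocalization_away` — GENERIC: if `Bl_J(Spec R)` is
  regular, so is `Bl_{J·S}(Spec S)` for any localisation `S = R[1/r]`: `Spec S → Spec R` is an open
  immersion, hence flat, so `Bl_J(Spec R) ×_{Spec R} Spec S → Spec S` is a blow-up along `J·S`
  (Literature `IsBlowup.pullback_snd_of_flat`, Görtz–Wedhorn I Prop. 13.91 (2)); it is an open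
  subscheme of the regular `Bl_J(Spec R)`; and `Bl_{J·S}(Spec S)` is isomorphic to it over `Spec S`
  (uniqueness of blow-ups).
* `Half111.isPrime_map_span_gens` — `𝔪₂ · A[1/q]` is prime for `q ∉ 𝔪₂` (from
  `Half111.span_gens_isPrime` of `…JordanFourConeVertexIdeals`; `Q ≡ 1 mod 𝔪₂` in V4U).
* `Half111.isRegular_affineBlowup_map_away` — the instance for the `½(1,1,1) × 𝔸` cone, any `q`, any
  `IsLocalization.Away q S` model `S` of `A[1/q]`: the `hreg` input of p489276 for `HP₁`.
-/

-- single-problem summit: the doubled namespace component `ResolutionOfSingularities` is forced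
set_option linter.dupNamespace false

noncomputable section

universe u

open CategoryTheory CategoryTheory.Limits AlgebraicGeometry MvPolynomial
open Literature.AlgebraicGeometry.Resolution

namespace Summit.ResolutionOfSingularities.ResolutionOfSingularities.Theorems.WildQuotientResolution

/-! ## Generic: regularity of an affine blow-up survives localisation of the base -/

namespace ConeVertex

/-- **Blow-ups commute with localisation, and regularity survives.** If `Bl_J(Spec R)` is regular
and `S = R[1/r]` (`IsLocalization.Away r S`), then `Bl_{J·S}(Spec S)` is regular: `Spec S → Spec R`
is an open immersion, hence flat, so `Bl_J(Spec R) ×_{Spec R} Spec S → Spec S` is a blow-up along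
`J·S` (Literature `IsBlowup.pullback_snd_of_flat`, Görtz–Wedhorn I Prop. 13.91 (2)); it is an open
subscheme of the regular `Bl_J(Spec R)`, and `Bl_{J·S}(Spec S)` is isomorphic to it (uniqueness of
blow-ups). [folklore] -/
theorem isRegular_affineBlowup_map_of_isLocalization_away {R S : Type u} [CommRing R]
    [CommRing S] [Algebra R S] (r : R) [IsLocalization.Away r S] (J : Ideal R)
    (h : Scheme.IsRegular (affineBlowup J)) :
    Scheme.IsRegular (affineBlowup (J.map (algebraMap R S))) := by
  haveI : IsOpenImmersion (Spec.map (CommRingCat.ofHom (algebraMap R S))) :=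
    IsOpenImmersion.of_isLocalization r
  have hb : IsBlowup (pullback.snd (affineBlowup.π J) (Spec.map (CommRingCat.ofHom (algebraMap R S))))
      ((affineBlowup.idealSheaf J).comap (Spec.map (CommRingCat.ofHom (algebraMap R S)))) :=
    (affineBlowup.isBlowup J).pullback_snd_of_flat _
  have hI : (affineBlowup.idealSheaf J).comap (Spec.map (CommRingCat.ofHom (algebraMap R S))) =
      affineBlowup.idealSheaf (J.map (algebraMap R S)) := by
    rw [affineBlowup.idealSheaf, affineBlowup.idealSheaf, comap_ofIdealTop_SpecMap]
  rw [hI] at hb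
  obtain ⟨e, -, -⟩ := hb.unique (affineBlowup.isBlowup (J.map (algebraMap R S)))
  have hP : Scheme.IsRegular
      (pullback (affineBlowup.π J) (Spec.map (CommRingCat.ofHom (algebraMap R S)))) := by
    intro x
    haveI := h ((pullback.fst (affineBlowup.π J)
      (Spec.map (CommRingCat.ofHom (algebraMap R S)))) x)
    exact IsRegularLocalRing.of_ringEquiv (asIso ((pullback.fst (affineBlowup.π J)
      (Spec.map (CommRingCat.ofHom (algebraMap R S)))).stalkMap x)).commRingCatIsoToRingEquiv
  exact Scheme.IsRegular.of_iso e.hom hP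

end ConeVertex

/-! ## The `½(1,1,1)` cone localised off the vertex: prime centre, regular blow-up -/

namespace Half111

variable (k : Type) [Field k] (n : ℕ) (a b c : Fin n)

/-- **The vertex ideal stays prime after localising at an element off the vertex**: for `q ∉ 𝔪₂`
and `S = A[1/q]`, `𝔪₂ · S` is prime (the `μ₂` piece of V4U is the cone localised at the invariant
`Q ≡ 1 mod 𝔪₂`). [folklore] -/
theorem isPrime_map_span_gens (S : Type) [CommRing S]
    [Algebra (MvPolynomial (Fin n ⊕ Fin 3) k ⧸ RingHom.ker (presentation k n a b c)) S]
    (q : MvPolynomial (Fin n ⊕ Fin 3) k ⧸ RingHom.ker (presentation k n a b c))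
    [IsLocalization.Away q S]
    (hq : q ∉ Ideal.span (Set.range (fun l : Fin 6 =>
        Ideal.Quotient.mk (RingHom.ker (presentation k n a b c)) (gens k n a b c l)))) :
    ((Ideal.span (Set.range (fun l : Fin 6 =>
        Ideal.Quotient.mk (RingHom.ker (presentation k n a b c)) (gens k n a b c l)))).map
      (algebraMap _ S)).IsPrime := by
  refine IsLocalization.isPrime_of_isPrime_disjoint (Submonoid.powers q) S _
    (span_gens_isPrime k n a b c) ?_
  rw [Set.disjoint_left]
  rintro _ ⟨m, rfl⟩ hm
  exact hq ((span_gens_isPrime k n a b c).mem_of_pow_mem m hm)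

/-- **C4½ localised: `Bl_{𝔪₂}((½(1,1,1) × 𝔸)[1/q])` is regular** for every `q` — the «blow-up under
the flat base change `Γ ↦ Γ[1/Q]`» ingredient of the `μ₂` cone brick `HP₁`, as the `hreg` input of
`BlowupExit.exists_isBlowup_regular_of_iso_spec_of_ringEquiv` (the piece's ring being
`≅ A[1/Q]`, `A = k[Y] ⧸ ker presentation`). [OURS · L1 W4.5c] [folklore] -/
theorem isRegular_affineBlowup_map_away (hab : a ≠ b) (hbc : b ≠ c) (hac : a ≠ c) (S : Type)
    [CommRing S]
    [Algebra (MvPolynomial (Fin n ⊕ Fin 3) k ⧸ RingHom.ker (presentation k n a b c)) S]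
    (q : MvPolynomial (Fin n ⊕ Fin 3) k ⧸ RingHom.ker (presentation k n a b c))
    [IsLocalization.Away q S] :
    Scheme.IsRegular (affineBlowup ((Ideal.span (Set.range (fun l : Fin 6 =>
        Ideal.Quotient.mk (RingHom.ker (presentation k n a b c)) (gens k n a b c l)))).map
      (algebraMap _ S))) :=
  ConeVertex.isRegular_affineBlowup_map_of_isLocalization_away q _
    (blowup_regular k n a b c hab hbc hac).1

end Half111

end Summit.ResolutionOfSingularities.ResolutionOfSingularities.Theorems.WildQuotientResolution

end
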